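import Summits.CriticalPhenomena.PercolationContinuityZ3.Theorems.PercNearOneGluingNoHeavyLowerTailIncStarCycle
import HarnessLib

/-!
# Sahi positivity of every order for the GROUP-connection events `{0 ↔ T}` of a weighted cycle

Support file for the Sahi programme (`--supports stmt-CriticalPhenomena-4575`, prover prim-sahi-p2 gen 8).
No definitions, no named facts, no sorries; standard axioms.  Memo `…/prim-sahi-p2/PROOF-E3.md` §19.

`…IncStarCycle.lean` treats the point events `{0 ↔ t}` on a cycle.  Here: the events "the root is joined to AT
LEAST ONE vertex of the set `T`", `⋃_{t ∈ T} {0 ↔ t}` (the union-closed family generated by the root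
connections; group connections in the language of `Literature…Percolation`), for arbitrary nonempty vertex sets
`T₀, …, T_{n−1}`, satisfy `E_n ≥ 0` on every weighted cycle (`sahiE_groupConn_cycle_nonneg`).

The abstract input is a two-parameter form of the two-chain theorem
(`TwoChainUnions.sahiE_nonneg_of_twoChainUnions_pairs`): events `R (a i) ∪ L (b i)` with `a i ≤ b i`, for a
shrinking chain `R` and a growing chain `L` whose complements `(R k)ᶜ`, `(L k')ᶜ` are uncorrelated for
`k ≤ k'`.  On the cycle, `⋃_{t∈T} {0 ↔ t}` is (almost surely) the right arc to `min T` union the left arc to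
`max T`.
-/

noncomputable section

namespace Summit.CriticalPhenomena.PercolationContinuityZ3.Theorems

namespace TwoChainUnions

open Finset Literature.Combinatorics.Sahi2008
open Literature.Probability.Percolation.DecisionTree (ind ind_of_mem ind_of_not_mem ind_nonneg)
open scoped Classical

variable {α : Type*} [Fintype α] {K : ℕ}

/-- **Two-chain unions, two-parameter form.**  `μ` a probability weight on a finite type; `R k` shrinking and
`L k` growing in `k : Fin K`, with `(R k)ᶜ`, `(L k')ᶜ` uncorrelated for `k ≤ k'`.  Then for all `n` and all
`a b : Fin n → Fin K` with `a i ≤ b i`, `0 ≤ E_n(1_{R (a 0) ∪ L (b 0)}, …, 1_{R (a (n−1)) ∪ L (b (n−1))})`.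
[this work] -/
theorem sahiE_nonneg_of_twoChainUnions_pairs (μ : α → ℝ) (hμ0 : ∀ x, 0 ≤ μ x) (hμ1 : ∑ x, μ x = 1)
    (R L : Fin K → Set α)
    (hR : ∀ ⦃k k' : Fin K⦄, k ≤ k' → R k' ⊆ R k) (hL : ∀ ⦃k k' : Fin K⦄, k ≤ k' → L k ⊆ L k')
    (hind : ∀ k k' : Fin K, k ≤ k' →
      ex μ (ind (R k)ᶜ * ind (L k')ᶜ) = ex μ (ind (R k)ᶜ) * ex μ (ind (L k')ᶜ))
    (n : ℕ) (a b : Fin n → Fin K) (hab : ∀ i, a i ≤ b i) :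
    0 ≤ sahiE μ n (fun i => ind (R (a i) ∪ L (b i))) := by
  -- the two chain levels
  let ρ : α → Fin (K + 1) := fun x =>
    ⟨(univ.filter fun k : Fin K => x ∈ R k).card,
      Nat.lt_succ_of_le ((card_filter_le _ _).trans (by rw [Finset.card_fin]))⟩
  let lam : α → Fin (K + 1) := fun x =>
    ⟨(univ.filter fun k : Fin K => x ∈ L k).card,
      Nat.lt_succ_of_le ((card_filter_le _ _).trans (by rw [Finset.card_fin]))⟩
  have hρ : ∀ x (k : Fin K), x ∈ R k ↔ k.val < (ρ x).val := by
    intro x k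
    have h := mem_iff_lt_card_of_lower (D := univ.filter fun k : Fin K => x ∈ R k)
      (fun k k' hkk' hk => by
        simp only [mem_filter, mem_univ, true_and] at hk ⊢
        exact hR hkk' hk) k
    simpa only [mem_filter, mem_univ, true_and] using h
  have hlam : ∀ x (k : Fin K), x ∈ L k ↔ K - (lam x).val ≤ k.val := by
    intro x k
    have h := mem_iff_sub_card_le_of_upper (U := univ.filter fun k : Fin K => x ∈ L k)
      (fun k k' hkk' hk => by
        simp only [mem_filter, mem_univ, true_and] at hk ⊢
        exact hL hkk' hk) k
    simpa only [mem_filter, mem_univ, true_and] using h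
  -- the model: product of the two level laws on `Fin (K+1) × Fin (K+1)`, monotone union indicators
  let w₁ : Fin (K + 1) → ℝ := pushWeight μ ρ
  let w₂ : Fin (K + 1) → ℝ := pushWeight μ lam
  let W : Fin (K + 1) × Fin (K + 1) → ℝ := fun p => w₁ p.1 * w₂ p.2
  let G₁ : Fin K → Fin (K + 1) → ℝ := fun k r => if k.val < r.val then 0 else 1
  let G₂ : Fin K → Fin (K + 1) → ℝ := fun k l => if K - l.val ≤ k.val then 0 else 1
  let g : Fin n → Fin (K + 1) × Fin (K + 1) → ℝ := fun i p =>
    if (a i).val < p.1.val ∨ K - p.2.val ≤ (b i).val then 1 else 0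
  have hpos : SahiPositive W n :=
    ProductChains.sahiPositive_prodWeight_linearOrder w₁ w₂ (pushWeight_nonneg hμ0 _)
      (by rw [sum_pushWeight, hμ1]) (pushWeight_nonneg hμ0 _) (by rw [sum_pushWeight, hμ1]) n
  have hg0 : ∀ (i : Fin n) p, 0 ≤ g i p := by
    intro i p
    simp only [g]
    split_ifs <;> norm_num
  have hgm : ∀ i : Fin n, Monotone (g i) := by
    intro i p q hpq
    simp only [g]
    by_cases hp : (a i).val < p.1.val ∨ K - p.2.val ≤ (b i).val
    · have hq : (a i).val < q.1.val ∨ K - q.2.val ≤ (b i).val := by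
        rcases hp with hp | hp
        · exact Or.inl (lt_of_lt_of_le hp (Fin.le_def.1 hpq.1))
        · refine Or.inr (le_trans ?_ hp)
          have := Fin.le_def.1 hpq.2
          omega
      rw [if_pos hp, if_pos hq]
    · rw [if_neg hp]
      split_ifs <;> norm_num
  have hmodel : 0 ≤ sahiE W n (fun i => g i) := hpos _ hg0 hgm
  -- transfer along the avoidance moments
  rw [sahiE_congr_of_complMoments μ W (fun i => ind (R (a i) ∪ L (b i))) (fun i => g i) ?_]
  · exact hmodel
  intro T
  -- the two one-chain avoidance products
  set PR : α → ℝ := ∏ i ∈ T, ind (R (a i))ᶜ with hPR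
  set PL : α → ℝ := ∏ i ∈ T, ind (L (b i))ᶜ with hPL
  -- (i) the real side is `E[PR · PL]`
  have hreal : (∏ i ∈ T, ((1 : α → ℝ) - ind (R (a i) ∪ L (b i)))) = PR * PL := by
    rw [hPR, hPL, ← prod_mul_distrib]
    exact prod_congr rfl fun i _ => one_sub_ind_union _ _
  -- (ii) `E[PR · PL] = E[PR] E[PL]`
  have hfac : ex μ (PR * PL) = ex μ PR * ex μ PL := by
    rcases T.eq_empty_or_nonempty with hT | hT
    · have h1 : PR = 1 := by rw [hPR, hT, prod_empty]
      have h2 : PL = 1 := by rw [hPL, hT, prod_empty]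
      rw [h1, h2, one_mul, ex_one hμ1, one_mul]
    · obtain ⟨i₀, hi₀, hmin⟩ := Finset.exists_min_image T a hT
      obtain ⟨j₀, hj₀, hmax⟩ := Finset.exists_max_image T b hT
      have hPRa : PR = ind (R (a i₀))ᶜ :=
        prod_ind_compl_eq_of_subset T (fun i => R (a i)) hi₀ fun i hi => hR (hmin i hi)
      have hPLb : PL = ind (L (b j₀))ᶜ :=
        prod_ind_compl_eq_of_subset T (fun i => L (b i)) hj₀ fun i hi => hL (hmax i hi)
      rw [hPRa, hPLb]
      exact hind (a i₀) (b j₀) ((hmin j₀ hj₀).trans (hab j₀))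
  -- (iii) the model side factorises as `E_μ[PR] E_μ[PL]`
  have hmodelprod : (∏ i ∈ T, ((1 : Fin (K + 1) × Fin (K + 1) → ℝ) - g i)) =
      fun p => (∏ i ∈ T, G₁ (a i) p.1) * (∏ i ∈ T, G₂ (b i) p.2) := by
    funext p
    rw [Finset.prod_apply, ← prod_mul_distrib]
    refine prod_congr rfl fun i _ => ?_
    simp only [Pi.sub_apply, Pi.one_apply, g, G₁, G₂]
    by_cases h1 : (a i).val < p.1.val
    · simp [h1]
    · by_cases h2 : K - p.2.val ≤ (b i).val
      · simp [h1, h2]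
      · simp [h1, h2]
  have hG₁ : (fun x => ∏ i ∈ T, G₁ (a i) (ρ x)) = PR := by
    funext x
    rw [hPR, Finset.prod_apply]
    refine prod_congr rfl fun i _ => ?_
    simp only [G₁]
    by_cases hx : x ∈ R (a i)
    · rw [if_pos ((hρ x (a i)).1 hx), ind_of_not_mem (show x ∉ (R (a i))ᶜ from fun h => (Set.mem_compl_iff _ _).mp h hx)]
    · rw [if_neg (fun h => hx ((hρ x (a i)).2 h)), ind_of_mem (show x ∈ (R (a i))ᶜ from hx)]
  have hG₂ : (fun x => ∏ i ∈ T, G₂ (b i) (lam x)) = PL := by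
    funext x
    rw [hPL, Finset.prod_apply]
    refine prod_congr rfl fun i _ => ?_
    simp only [G₂]
    by_cases hx : x ∈ L (b i)
    · rw [if_pos ((hlam x (b i)).1 hx), ind_of_not_mem (show x ∉ (L (b i))ᶜ from fun h => (Set.mem_compl_iff _ _).mp h hx)]
    · rw [if_neg (fun h => hx ((hlam x (b i)).2 h)), ind_of_mem (show x ∈ (L (b i))ᶜ from hx)]
  have hmodelex : ex W (∏ i ∈ T, ((1 : Fin (K + 1) × Fin (K + 1) → ℝ) - g i)) =
      ex μ PR * ex μ PL := by
    rw [hmodelprod]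
    rw [ex_prodWeight_mul w₁ w₂ (fun r => ∏ i ∈ T, G₁ (a i) r) (fun l => ∏ i ∈ T, G₂ (b i) l)]
    rw [show ex w₁ (fun r => ∏ i ∈ T, G₁ (a i) r) = ex μ PR from by
        rw [show w₁ = pushWeight μ ρ from rfl, ex_pushWeight, ← hG₁]; rfl,
      show ex w₂ (fun l => ∏ i ∈ T, G₂ (b i) l) = ex μ PL from by
        rw [show w₂ = pushWeight μ lam from rfl, ex_pushWeight, ← hG₂]; rfl]
  rw [hreal, hfac, hmodelex]



end TwoChainUnions

namespace IncStarCycle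

open Finset MeasureTheory Literature.Combinatorics.Sahi2008 Literature.Probability.Percolation
  Literature.Probability.LatticeModels
open Literature.Probability.Percolation.DecisionTree (ind ind_of_mem ind_of_not_mem ind_nonneg)
open Literature.Probability.Percolation.BHK2006 (weight)
open scoped Classical

variable {m : ℕ} [NeZero m]

/-- On a cycle, "the root meets the set `T`" is the right arc to `min T` union the left arc to `max T` (on
configurations whose open edges are cycle edges, `m ≥ 2`). [this work] -/
theorem groupConn_iff_arcs (hm : 2 ≤ m) {ω : BondConfig (Fin m)}
    (hω : ∀ u u' : Fin m, (openGraph ω).Adj u u' → ∃ k : Fin m, s(u, u') = s(k, k + 1))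
    (T : Finset (Fin m)) (hT : T.Nonempty) :
    ω ∈ (⋃ t ∈ T, openConn (0 : Fin m) t) ↔
      ω ∈ {ω : BondConfig (Fin m) | ∀ j : Fin m, j.val < (T.min' hT).val → s(j, j + 1) ∈ ω} ∪
        {ω | ∀ j : Fin m, (T.max' hT).val ≤ j.val → s(j, j + 1) ∈ ω} := by
  constructor
  · intro h
    simp only [Set.mem_iUnion] at h
    obtain ⟨t, ht, hωt⟩ := h
    rcases (openConn_iff_arcs hm hω t).1 hωt with h | h
    · left
      intro j hj
      exact h j (lt_of_lt_of_le hj (Fin.le_def.1 (T.min'_le t ht)))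
    · right
      intro j hj
      exact h j (le_trans (Fin.le_def.1 (T.le_max' t ht)) hj)
  · rintro (h | h)
    · simp only [Set.mem_iUnion]
      exact ⟨T.min' hT, T.min'_mem hT, (openConn_iff_arcs hm hω _).2 (Or.inl h)⟩
    · simp only [Set.mem_iUnion]
      exact ⟨T.max' hT, T.max'_mem hT, (openConn_iff_arcs hm hω _).2 (Or.inr h)⟩

/-- **Sahi positivity of every order for the group-connection events of a weighted cycle.**  Let `m ≥ 3`, let `w`
vanish off the cycle edges `s(j, j+1)`, and let `T₀, …, T_{n−1}` be nonempty sets of vertices.  Then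
`0 ≤ E_n(1_{0 ↔ T₀}, …, 1_{0 ↔ T_{n−1}})`, where `{0 ↔ T} = ⋃_{t∈T} {0 ↔ t}`. [this work] -/
theorem sahiE_groupConn_cycle_nonneg (hm : 3 ≤ m) (w : Sym2 (Fin m) → unitInterval)
    (hw : ∀ e : Sym2 (Fin m), (∀ j : Fin m, e ≠ s(j, j + 1)) → w e = 0) (n : ℕ)
    (T : Fin n → Finset (Fin m)) (hT : ∀ i, (T i).Nonempty) :
    0 ≤ sahiE (bernoulliWeight w) n (fun i => ind (⋃ t ∈ T i, openConn (0 : Fin m) t)) := by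
  let R : Fin m → Set (BondConfig (Fin m)) := fun v => {ω | ∀ j : Fin m, j.val < v.val → s(j, j + 1) ∈ ω}
  let L : Fin m → Set (BondConfig (Fin m)) := fun v => {ω | ∀ j : Fin m, v.val ≤ j.val → s(j, j + 1) ∈ ω}
  let a : Fin n → Fin m := fun i => (T i).min' (hT i)
  let b : Fin n → Fin m := fun i => (T i).max' (hT i)
  have harc : ∀ ω : BondConfig (Fin m), bernoulliWeight w ω ≠ 0 → ∀ i : Fin n,
      (ω ∈ (⋃ t ∈ T i, openConn (0 : Fin m) t) ↔ ω ∈ R (a i) ∪ L (b i)) := by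
    intro ω hω i
    refine groupConn_iff_arcs (by omega) (fun u u' hadj => ?_) (T i) (hT i)
    by_cases hne : ∃ k : Fin m, s(u, u') = s(k, k + 1)
    · exact hne
    · exfalso
      rw [openGraph_adj] at hadj
      exact hω (bernoulliWeight_eq_zero_of_mem w hadj.1 (hw _ fun j hj => hne ⟨j, hj⟩))
  have hmom : ∀ S : Finset (Fin n),
      ex (bernoulliWeight w) (∏ i ∈ S, ind (⋃ t ∈ T i, openConn (0 : Fin m) t)) =
        ex (bernoulliWeight w) (∏ i ∈ S, ind (R (a i) ∪ L (b i))) := by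
    intro S
    rw [ex_def, ex_def]
    refine Finset.sum_congr rfl fun ω _ => ?_
    by_cases hω : bernoulliWeight w ω = 0
    · rw [hω, zero_mul, zero_mul]
    · congr 1
      rw [Finset.prod_apply, Finset.prod_apply]
      refine Finset.prod_congr rfl fun i _ => ?_
      by_cases h : ω ∈ (⋃ t ∈ T i, openConn (0 : Fin m) t)
      · rw [ind_of_mem h, ind_of_mem ((harc ω hω i).1 h)]
      · rw [ind_of_not_mem h, ind_of_not_mem (fun h' => h ((harc ω hω i).2 h'))]
  rw [TwoChainUnions.sahiE_congr_of_prodMoments (bernoulliWeight w) (bernoulliWeight w) n _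
    (fun i => ind (R (a i) ∪ L (b i))) hmom]
  refine TwoChainUnions.sahiE_nonneg_of_twoChainUnions_pairs (bernoulliWeight w)
    (isFKGMeasure_bernoulliWeight w).nonneg (sum_bernoulliWeight w) R L
    (fun v v' h _ hω j hj => hω j (lt_of_lt_of_le hj (Fin.le_def.1 h)))
    (fun v v' h _ hω j hj => hω j (le_trans (Fin.le_def.1 h) hj)) (fun v v' hvv' => ?_) n a b
    (fun i => (T i).min'_le _ ((T i).max'_mem (hT i)))
  have h := real_rightArc_compl_inter_leftArc_compl hm w hvv'
  rw [← ex_bernoulliWeight_ind, ← ex_bernoulliWeight_ind, ← ex_bernoulliWeight_ind] at h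
  have hprod : ind ((R v)ᶜ ∩ (L v')ᶜ) = ind (R v)ᶜ * ind (L v')ᶜ := by
    funext ω; exact BHK2006.ind_inter _ _ ω
  rw [hprod] at h
  exact h

end IncStarCycle

end Summit.CriticalPhenomena.PercolationContinuityZ3.Theorems
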